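/-
Copyright (c) 2026 the pub-hodgecm-mathlib formalisation cell (harness21).  Prover seat hodgecm-mathlib-K2Liu-p26 (g2): Track B «K2-LIT»,
#184♮ = hLiu418 = stmt-HodgeConjecture-24832; #42F′ FACE-G, organ F4 (G-gen), road (E) «compact see-saw + FFT + PBW + `K_H`-averaging» (RULING M-158r∕M-158s,
F4 lead K2Liu-p27 (g2) ROAD VERDICT 23:03:11Z), brick (E-d) STEP 3: THE `K_H`-AVERAGING — §1 the generic compact averaging on a `K_H`-stable Banach
(finite-dimensional) subspace; §2 (the one-place Schwartz∕junction instance) follows the (E-b)∕(E-e) letters by the append protocol.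
-/
import Literature.RepresentationTheory.CompactGroups.UnitaryTrick    -- ★ `CompactGroup.integrable_of_continuous`, `isProbabilityMeasure_haarMeasure_top`, two-sided invariance
import Mathlib.MeasureTheory.Integral.Bochner.ContinuousLinearMap
import Mathlib.MeasureTheory.Group.Integral
import HarnessLib

/-!
# Crux `HLiu418`, #42F′ FACE-G, organ F4 (G-gen), road (E), brick (E-d) STEP 3: COMPACT `K_H`-AVERAGING — `P a := ∫_{K_H} ω(k) a dk` is `K_H`-invariant,
# fixes invariants, and is INVISIBLE to every `K_H`-invariant continuous linear map (the Siegel–Weil section `a ↦ SW_σ(a)`): `SW(P a) = SW(a)`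

Cell `hodgecm-mathlib`, crux item hLiu418 = `stmt-HodgeConjecture-24832`, route of record `HCCMUnconditional`; squad K2 ∕ K2Liu, road `K2_Liu`, socket #42F′,
FACE-G ∕ organ F4 (G-gen); F4 lead K2Liu-p27 (g2) (ROAD VERDICT (E) 2026-09-04T23:03:11Z: «(E-d) `K2LiuLocalThetaKHAveraging` → K2Liu-p26»; desks K2Liu-p10 (g6),
K2E5-r02 (g6) — road (E) author).  THEOREMS ONLY (no `def`, no `instance`, no `notation`, no named-fact hypothesis, no `sorry`); lane
`--supports stmt-HodgeConjecture-24832` (count-neutral helper).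

WHY (r02's road (E), STEP 3).  At a real place `σ`, `G = U(2,2)(ℝ) ⊃ K̃`, `H_σ = U(p,q) ⊃ K_H = U(p)×U(q)` act on `𝓢(V′_σ²)` by the Weil representation; STEP 1∕2
((E-a)(E-b)(E-c)(E-e)) give `𝓢^{K_H}_{K̃-fin} = U(𝔤)·φ°`.  STEP 3: for a `K̃`-finite `a`, the average `P a := ∫_{K_H} ω(k) a dk` is `K_H`-INVARIANT and `K̃`-finite,
hence a word in the (E-b) operators applied to `φ°`, while the section map `a ↦ SW_σ(a)` — LINEAR and `K_H`-INVARIANT (`ω(k)` commutes with `ω(g)` and fixes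
the value at `0`) — does not see the averaging: `SW_σ(P a) = SW_σ(a)`, i.e. `a = P a + (a − P a)` with `SW_σ(a − P a) = 0` = the (R-gen) generation letter.
NO Bochner integral on the Fréchet space `𝓢` is needed: a `K̃`-finite `a` lives in a FINITE-DIMENSIONAL `K_H`-stable subspace `W` (polynomial · Gaussian of
bounded degree), where the average is a Bochner integral in a Banach space and every linear functional is continuous.  THIS FILE (§1) is that generic step,
model-free: a compact group `K` with a Haar probability measure `μ`, a Banach space `W`, a homomorphism `ρ : K →* (W →L[ℂ] W)` with continuous orbit maps.
* `integrable_orbit` — `k ↦ ρ k w` is integrable (continuous on a compact group; ★ `CompactGroup.integrable_of_continuous`).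
* **`apply_integral_orbit_eq`** — `ρ h (∫ k, ρ k w ∂μ) = ∫ k, ρ k w ∂μ` (the average is `K`-invariant: `ContinuousLinearMap.integral_comp_comm` + left invariance).
* **`integral_orbit_eq_self_of_forall_eq`** — `(∀ k, ρ k w = w) → ∫ k, ρ k w ∂μ = w` (the average fixes invariants; `μ` a probability measure).
* **`map_integral_orbit_eq`** — for a continuous linear `f : W →L[ℂ] V` with `f ∘ ρ k = f` (all `k`): `f (∫ k, ρ k w ∂μ) = f w`; corollary
  **`sub_integral_orbit_mem_ker`**: `w − ∫ k, ρ k w ∂μ ∈ ker f` — STEP 3's «`a = P a + k`, `f_k = 0`».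
§2 (ED. 2, after (E-b) `K2LiuFockPActionLetters` ∕ (E-e) `K2LiuFockInvariantsHermite` fix the one-place currency): `K := K_H`, `W :=` the `K̃×K_H`-stable finite-dimensional
span of a `K̃`-finite Schwartz vector in ★ Konno–Konno's `weilRepPair` `H`-leg, `f := SW_σ` (evaluation of `ω(g)(·)` at `0`).
References: [Weyl1939] Ch. VIII §11 (averaging over the compact form); [BrockerTomDieck1985] II (1.7); [KudlaRallis1994] §3; [Howe1989] §3
(see-saw ∕ `K`-finite vectors of the oscillator representation); [GoodmanWallachGTM255] §3.3.4, §4.2 (Reynolds operator).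
HONEST LABEL.  Count-neutral helper; it retires nothing by itself: `HC_CM` is proved only modulo the 7 printed citations (2 remaining named inputs:
hLiu418 = `stmt-HodgeConjecture-24832`, h413 = `stmt-HodgeConjecture-24833`) until rung 0 closes.

## References
* [Weyl1939] H. Weyl, *The Classical Groups* (1939), Ch. VIII §11.
* [BrockerTomDieck1985] T. Bröcker, T. tom Dieck, *Representations of Compact Lie Groups* (1985), II (1.7).
* [KudlaRallis1994] S. S. Kudla, S. Rallis, Ann. of Math. 140 (1994), §3.
* [Howe1989] R. Howe, *Transcending classical invariant theory*, J. Amer. Math. Soc. 2 (1989), §3.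
* [GoodmanWallachGTM255] R. Goodman, N. R. Wallach, *Symmetry, Representations, and Invariants*, GTM 255 (2009), §3.3.4, §4.2.
-/

set_option autoImplicit false
set_option linter.dupNamespace false -- the mandated namespace repeats `HodgeConjecture.HodgeConjecture`

noncomputable section

open MeasureTheory MeasureTheory.Measure
open Literature.RepresentationTheory.CompactGroups

namespace Summit.HodgeConjecture.HodgeConjecture.Cruxes.HLiu418.K2LiuLocalThetaKHAveraging

/-! ## §1 Generic compact averaging on a `K`-stable Banach space -/

variable {K : Type*} [Group K] [TopologicalSpace K] [IsTopologicalGroup K] [CompactSpace K] [MeasurableSpace K] [BorelSpace K]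
  (μ : Measure K) [μ.IsHaarMeasure]
  {W : Type*} [NormedAddCommGroup W] [NormedSpace ℂ W] [CompleteSpace W]
  (ρ : K →* (W →L[ℂ] W)) (hρ : ∀ w : W, Continuous fun k : K => ρ k w)

omit [IsTopologicalGroup K] [CompleteSpace W] in
include hρ in
/-- the orbit map `k ↦ ρ k w` is integrable against a Haar measure on the compact group (continuous on a compact space; ★ `CompactGroup.integrable_of_continuous`).
[cite: BrockerTomDieck1985, II (1.7)] -/
theorem integrable_orbit (w : W) : Integrable (fun k : K => ρ k w) μ :=
  CompactGroup.integrable_of_continuous (hρ w)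

include hρ in
/-- **THE AVERAGE IS `K`-INVARIANT**: `ρ h (∫ k, ρ k w ∂μ) = ∫ k, ρ k w ∂μ` — push `ρ h` through the Bochner integral (`ContinuousLinearMap.integral_comp_comm`),
`ρ h ∘ ρ k = ρ (h·k)`, and use left invariance of `μ` (`integral_mul_left_eq_self`). [cite: Weyl1939, Ch. VIII §11] [cite: GoodmanWallachGTM255, §4.2] -/
theorem apply_integral_orbit_eq (h : K) (w : W) : ρ h (∫ k, ρ k w ∂μ) = ∫ k, ρ k w ∂μ := by
  rw [← ContinuousLinearMap.integral_comp_comm (ρ h) (integrable_orbit μ ρ hρ w)]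
  have hmul : (fun k : K => ρ h (ρ k w)) = fun k : K => ρ (h * k) w := by
    funext k
    rw [map_mul]
    rfl
  rw [hmul]
  exact integral_mul_left_eq_self (fun k : K => ρ k w) h

omit [TopologicalSpace K] [IsTopologicalGroup K] [CompactSpace K] [BorelSpace K] [μ.IsHaarMeasure] in
/-- **THE AVERAGE FIXES INVARIANTS**: if `ρ k w = w` for all `k` then `∫ k, ρ k w ∂μ = w` (`μ` a probability measure). [cite: BrockerTomDieck1985, II (1.7)] -/
theorem integral_orbit_eq_self_of_forall_eq [IsProbabilityMeasure μ] (w : W) (hw : ∀ k : K, ρ k w = w) : ∫ k, ρ k w ∂μ = w := by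
  simp only [hw, integral_const, probReal_univ, one_smul]

omit [IsTopologicalGroup K] in
include hρ in
/-- **A `K`-INVARIANT CONTINUOUS LINEAR MAP DOES NOT SEE THE AVERAGE**: `f (∫ k, ρ k w ∂μ) = f w` whenever `f (ρ k w′) = f w′` for all `k, w′` (`μ` a probability
measure) — at the instance `f := SW_σ` (the Siegel–Weil section, `K_H`-invariant because `ω(K_H)` commutes with `ω(G)` and fixes the value at `0`): `SW_σ(P a) = SW_σ(a)`.
[cite: KudlaRallis1994, §3] [cite: Howe1989, §3] -/
theorem map_integral_orbit_eq [IsProbabilityMeasure μ] {V : Type*} [NormedAddCommGroup V] [NormedSpace ℂ V] [CompleteSpace V] (f : W →L[ℂ] V)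
    (hf : ∀ (k : K) (w' : W), f (ρ k w') = f w') (w : W) : f (∫ k, ρ k w ∂μ) = f w := by
  rw [← ContinuousLinearMap.integral_comp_comm f (integrable_orbit μ ρ hρ w)]
  simp only [hf, integral_const, probReal_univ, one_smul]

omit [IsTopologicalGroup K] in
include hρ in
/-- **STEP 3's LETTER «`a = P a + k`, `f k = 0`»**: `w − ∫ k, ρ k w ∂μ ∈ ker f` for every `K`-invariant continuous linear `f`.
[cite: KudlaRallis1994, §3] [cite: Howe1989, §3] -/
theorem sub_integral_orbit_mem_ker [IsProbabilityMeasure μ] {V : Type*} [NormedAddCommGroup V] [NormedSpace ℂ V] [CompleteSpace V] (f : W →L[ℂ] V)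
    (hf : ∀ (k : K) (w' : W), f (ρ k w') = f w') (w : W) : w - ∫ k, ρ k w ∂μ ∈ LinearMap.ker (f : W →ₗ[ℂ] V) := by
  rw [LinearMap.mem_ker, ContinuousLinearMap.coe_coe, map_sub, map_integral_orbit_eq μ ρ hρ f hf w, sub_self]

/-- **THE NORMALISED HAAR MEASURE QUALIFIES**: `haarMeasure ⊤` on the compact group is a Haar probability measure (★ `isProbabilityMeasure_haarMeasure_top`), so the
three statements above hold for `μ := haarMeasure ⊤` — packaged for the consumer: `K`-invariance, fixing of invariants, and invisibility to `K`-invariant maps.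
[cite: Weyl1939, Ch. VIII §11] [cite: BrockerTomDieck1985, II (1.7)] -/
theorem haarAverage_package (hρc : ∀ w : W, Continuous fun k : K => ρ k w) (w : W) :
    (∀ h : K, ρ h (∫ k, ρ k w ∂haarMeasure (⊤ : TopologicalSpace.PositiveCompacts K)) = ∫ k, ρ k w ∂haarMeasure (⊤ : TopologicalSpace.PositiveCompacts K)) ∧
      ((∀ k : K, ρ k w = w) → ∫ k, ρ k w ∂haarMeasure (⊤ : TopologicalSpace.PositiveCompacts K) = w) ∧
      ∀ {V : Type*} [NormedAddCommGroup V] [NormedSpace ℂ V] [CompleteSpace V] (f : W →L[ℂ] V),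
        (∀ (k : K) (w' : W), f (ρ k w') = f w') → f (∫ k, ρ k w ∂haarMeasure (⊤ : TopologicalSpace.PositiveCompacts K)) = f w := by
  haveI := CompactGroup.isProbabilityMeasure_haarMeasure_top (G := K)
  exact ⟨fun h => apply_integral_orbit_eq _ ρ hρc h w, fun hw => integral_orbit_eq_self_of_forall_eq _ ρ w hw,
    fun f hf => map_integral_orbit_eq _ ρ hρc f hf w⟩

end Summit.HodgeConjecture.HodgeConjecture.Cruxes.HLiu418.K2LiuLocalThetaKHAveraging

end
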